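/-
COR-CM (cell pub-hodgecm2, stage 2 of the Hodge ladder) — PLANNER-A «mukey» lane, HMUSEP (R-34′): THE 7-ROW VARIANT «MuKeyIdent − hμsep-LEG».
The cross-μ binder `hμsep` of ✔ `MuKeyIdentEnd.hc_cm_of_printed_citations_muKey_ident` (`D2Bridge/ClosedPrintedMuKeyIdent.lean`, p375902) — the ONE
displayed row that was a labelled LEG (caveat (c)) — is DERIVED IN KERNEL from [Liu2021, App. D Lem. D.1 (3)] AS PRINTED per finite place, read on the
INDEXED FAMILY of the tree's own local data at `U(J_V)(F⁺_v)` of the admissible weight-one triples of `𝕌(a)` (✔ `Liu2021/LemD1AsPrintedIndexed`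
`LemD1_3AsPrintedI`, reading I3 «exact-or-narrower»; `Liu2021/Def411WeilCarriersLocalDataAtV` `localIndexedFamilyAtV`, p374067 — b10 g69's chain, credited:
restriction step ✔ `Def411WeilCarriersLocalTypesOfEquiv` [Flath Thm 3], weak approximation ✔ `CMSplittingCharLocalMuSeparates`), whose PAIR-form
Lem-D.1-(1) input is THE EXISTING ROW `hD1''` (same `localLemD1Data … j …` term; the family's index type is Σ over `hD1''`'s own `(μ, hμ, hw, j)` binders).
Pen prover-pub-hodgecm2-mukey-p4-g2-0; rows `h ∕ h21 ∕ hLiu418 ∕ h411 ∕ h413 ∕ hD1''` BYTE-SLICED from the tree END p375902 :97–:143 by `gen_end7_v4c.py`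
(nothing retyped); ONE new row `hD3`; §1 is the generic closer (frame-generic, after b10's `UniformOmegaMuSep` closer, 7-row shape).
THEOREMS ONLY (kernel lane): no `def`, no instance, no `variable`, no notation, no `sorry`.
FRAMING: HC_CM is NOT proved unconditionally — the seven displayed citations are hypotheses; whether this is an END of record is the
coordinator's ∕ referees' ∕ auditors' call.  HELD — WORLD = C FINAL.
-/
import Summits.HodgeConjecture.CorCM.D2Bridge.ClosedPrintedMuKeyIdent
import Literature.NumberTheory.Automorphic.Liu2021.Def411WeilCarriersLocalDataAtV
import Literature.NumberTheory.GelbartRogawski1991.CMSplittingCharLocalMuSeparates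
import HarnessLib

/-!
# END «μ-KEY ⊕ ident − hμsep-LEG» (7 rows): `hμsep` derived from [Lem D.1 (3)] AS PRINTED on the indexed family + the displayed [Lem D.1 (1)] row

[Liu2021] Y. Liu, *Fourier–Jacobi cycles and arithmetic relative trace formula*, Camb. J. Math. **9** (2021) = arXiv:2102.11518 (`FJcycle.tex`):
Thm. 4.18 (2) «mutually non-isomorphic» is proved by «Statement (2) follows from Lemma D.1» (l. 2270) through «`ω(μ,ε,χ) := ⊗'_v ω(μ_v,ε_v,χ_v)`»
(Def. 4.11, l. 2092–2096) and the LOCAL Lemma D.1 (3) (l. 5233).  The tree's kernel passage for the CONSTRUCTED carriers `rhoAtLine` of `𝕌(a)`: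
an isomorphism `ω_s ≃ ω_t` of admissible summands restricts at every finite place `v` to an isomorphism of the local types at `U(J_V)(F⁺_v)` (Flath's
uniqueness, ✔ `nonempty_equiv_localTypes_of_equivId_of_isIrreducible`, irreducibility from [Lem D.1 (1)] AS PRINTED = the displayed `hD1''`), Lemma D.1 (3)
AS PRINTED on the indexed family (`hD3`) gives `μ_{s,v} = μ_{t,v}`, and «an idèle class character is determined by its local components»
(✔ `eq_of_forall_localMu_toHeckeCharacter_eq`, [CasselsFrohlich ANT, VII §8]) gives `μ_s = μ_t`.

* §1 `mu_eq_of_areIsomorphic_uniformOmegaRep_of_lemD1_3AsPrintedI` — the generic closer at `Model.uniformOmegaRep … (2δ_F)⁻¹ (fun _ _ => r)` (7-row shape).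
* §2 `hc_cm_of_printed_citations_muKey_ident_lemD3` — DISPLAY (7): `h` [Deligne1979] · `h21` [Shimura1998 Thm 21.4] · `hLiu418` [Liu2021 Thm 4.18] at the printed
  datum · `h411` [Def 4.11] · `h413` [Prop 4.13] · `hD3` [App. D Lem D.1 (3)] AS PRINTED per place on the indexed family (NEW, scalar-keyed) · `hD1''` [Lem D.1 (1)]
  AS PRINTED per place — rows 1–5 and 7 VERBATIM ✔ p375902's.  KERNEL: ONE application of ✔ `MuKeyIdentEnd.hc_cm_of_printed_citations_muKey_ident` with
  `hμsep :=` §1 at the pin (`e₁`, `frameD V`, `ιVE V` onto by ✔ `finPart_cmKTypeHom_finAdelicToAdelic_surjective`, `r := 𝕣(repAt a₀ i.1)`).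

## The index set of `hD3` (READING I3 of `LemD1AsPrintedIndexed`)
Member `(μw, j)` of the family at `(F, V, a, v)` = the local datum of [Liu2021, App. D §D.1] at `v` for `V` ITSELF: Step 2 `μ_v = localMu F (toHeckeCharacter F μw.1) v`,
Step 1 `(u·δ_F) ⊗ 1` with `u = 𝕣(a) j.1.1` (the representative section of record, convention (k1) of p375090), Step 3 `χ_v ∘ θ` for `χ = j.1.2`, carrier
`(chiLocalSplittingsD … (toHeckeCharacter F μw.1) … u).omegaLoc v ∘ (k ↦ k ⊗ 1) ∘ uEquiv` — the SAME local Weil datum the displayed `hD1''` row speaks about at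
`(a, μw.1, μw.2.1, μw.2.2, j, v)`, presented on `U(J_V)(F⁺_v)` (✔ `localLineInl`, onto).  Index set = «all (μ, ε, χ) with μ conjugate-symplectic of weight one and
ε μ-admissible» = [Liu2021, Prop. 4.13]'s printed index set (l. 2118), i.e. exactly the triples the END's `hμsep` quantifies over.

HELD — WORLD = C FINAL.  HC_CM is NOT proved unconditionally; nothing displayed is inhabited here.
-/

set_option autoImplicit false

noncomputable section

open scoped TensorProduct Matrix

namespace Summit.HodgeConjecture.CorCM.D2Bridge.MuKeyIdentLemD3End

open NumberField NumberField.InfinitePlace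
open HodgeCM.Model HodgeCM.Model.LiuIndex HodgeCM.Model.TowerCarrier
open HodgeCM.Literature.Theta.LiuAlbaneseModuleDatum.D2Bridge (HcmPieces)
open Summit.HodgeConjecture.CorCM.Model
open Literature.AlgebraicGeometry.Motives (CMType)
open Literature.AlgebraicGeometry.HodgeTheory Literature.NumberTheory.Automorphic.PicardCM
open Literature.AlgebraicGeometry.ShimuraVarieties.UnitaryCanonicalModel
open Literature.NumberTheory.ComplexMultiplication
open Literature.NumberTheory.Automorphic
open Literature.NumberTheory.Automorphic.IdeleClassGroup (toHeckeCharacter isUnitary_toHeckeCharacter galConj)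
open Literature.NumberTheory.Automorphic.Liu2021 Literature.NumberTheory.Automorphic.Liu2021.AppendixC
open Literature.NumberTheory.Automorphic.Liu2021.AppendixC.RestOne
open Literature.NumberTheory.Automorphic.Liu2021.Def411WeilCarriers (lineOf locF Rep)
open Summit.HodgeConjecture.CorCM.Transposition.OmegaTransport (realUnit)
open HodgeCM.Model.ArchSideTerm (e₁)
open Literature.NumberTheory.GelbartRogawski1991 Literature.NumberTheory.GelbartRogawski1991.UnitaryDualPair
open Literature.NumberTheory.GelbartRogawski1991.UnitaryDualPair.LocalSplitting (localMu norm_localMu continuous_localMu localMu_toLocalRing_eq_one_iff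
  eq_of_forall_localMu_toHeckeCharacter_eq)
open Literature.RepresentationTheory Literature.RepresentationTheory.Liu2021
open Summit.HodgeConjecture.CorCM.Transposition
open Summit.HodgeConjecture.CorCM.D2Bridge.AdapterMuConj (muConj prop413AsPrinted_muConj def411_muConj nontrivial_omegaAt_muConj_rest)
open Summit.HodgeConjecture.CorCM.D2Bridge.MuKeyIdentEnd (hc_cm_of_printed_citations_muKey_ident)

/-! ## §1  The cross-`μ` separation at `Model.uniformOmegaRep … (2δ_F)⁻¹ (fun _ _ => r)` from [Lem D.1 (3)] AS PRINTED on the indexed family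
(index = Σ over the rest's own `(μ, hμ, hw, j)`), the pair-form [Lem D.1 (1)] input being the displayed `hD1''` shape (generic in the frame) -/

/-- **`hμsep` at `Model.uniformOmegaRep h F ι₁ V Φ e dV hdV hdV0 ιV (2δ_F)⁻¹ (fun _ _ => r)` from [Liu2021, App. D Lem. D.1 (1), (3)] AS PRINTED per
place** («Statement (2) follows from Lemma D.1», l. 2270), the 7-ROW SHAPE: for `ιV` onto, [Lem. D.1 (1)] AS PRINTED at the PAIR datum of every
admissible index `j` of the rest `𝔯δ′⟦r, μ⟧ = restOfCharDeltaPrime … r μ hμ hw` at every finite place (`hD1R` — EXACTLY the END row `hD1''` at one scalar),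
and [Lem. D.1 (3)] AS PRINTED read on the indexed family `localIndexedFamilyAtV` of the tree's local data at `U(J_V)(F⁺_v)` of those same `(μ, hμ, hw, j)`
(`hD3`, index type `(μw : {μ // conj.-sympl. ∧ weight 1}) × AdmIndex 𝔯δ′⟦r, μw⟧`): two admissible triples `s, t` of [Prop. 4.13]'s datum
`U.prop413Data H` with `ω_s ≠ 0` and a `𝔾(𝔸_F^∞)`-equivariant `ℂ`-linear `ω_s ≃ ω_t` have THE SAME `μ`.  Route = ✔(-pending p374067)
`Def411WeilCarriers.forall_localMu_eq_of_equiv_of_lemD1AsPrintedI` (restriction to `U(J_V)(F⁺_v)` [Flath Thm 3], irreducible local types from `hD1R`,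
local separation from `hD3`) run on the LIGHT internal index `(U.prop413Data H).AdmTriple` (the triples themselves, at `s` and `t` on the nose), the
displayed Σ-indexed family being read on it by ✔ `LemD1_3AsPrintedI.comap` along `t ↦ (⟨μ_t, _⟩, ⟨(ε_t, χ_t), _⟩)` — an admissible triple of
`U.prop413Data H` IS an admissible index of the rest at its own `μ` (✔ `UniformOmega.admTripleOfRest`, read backwards; `restOfCharDeltaPrime = U.rest
(restTailOne …)` by ✔ `restOfCharRep_eq_rest`, `rfl`) — then weak approximation ✔ `eq_of_forall_localMu_toHeckeCharacter_eq`.  Nothing of [Liu2021] is asserted.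
[cite: Liu2021, Def. 4.11 (ll. 2083–2097), Prop. 4.13 (ll. 2113–2119), Thm. 4.18 (2) with proof l. 2270, App. D Lemma D.1 (1), (3) (l. 5229, 5233)]
[cite: FlathCorvallis1979, Theorem 3 (uniqueness clause)] [cite: CasselsFrohlichANT1967, Ch. VII §8] -/
theorem mu_eq_of_areIsomorphic_uniformOmegaRep_of_lemD1_3AsPrintedI (h : exists_recordSystem) (F : CMField) [IsGalois ℚ F]
    (h6 : 6 ≤ Module.finrank ℚ F) (ι₁ : F →+* ℂ) (V : HermSpace3 F ι₁) (Φ : CMType F) {n : ℕ} (e : Fin 3 × Fin 1 ≃ Fin n) (dV : Fin 3 → F)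
    (hdV : ∀ i, IsCMField.complexConj F (dV i) = dV i) (hdV0 : ∀ i, dV i ≠ 0)
    (ιV : (sec42DataOf h isoOf F ι₁ V Φ).G →* UnitaryGroup.finAdelic ↥(maximalRealSubfield F) F (IsCMField.complexConj F) 3 (Matrix.diagonal dV))
    (r : Rep ↥(maximalRealSubfield F) (imagUnitSq F)) (hn : 3 ≤ n)
    (H : Type) [AddCommGroup H] [Module ℂ H] [Module (MonoidAlgebra ℂ (sec42DataOf h isoOf F ι₁ V Φ).G) H]
    [IsScalarTower ℂ (MonoidAlgebra ℂ (sec42DataOf h isoOf F ι₁ V Φ).G) H]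
    (hιV : Function.Surjective ιV)
    (hD1R : ∀ (μ : Literature.NumberTheory.Automorphic.IdeleClassGroup F →ₜ* Circle) (hμ : IdeleClassGroup.IsConjugateSymplectic F μ)
      (hw : IdeleClassGroup.HasWeight F μ 1) (j : (toThm418Data _ (restOfCharDeltaPrime h F h6 ι₁ V Φ e dV hdV hdV0 ιV r μ hμ hw)).AdmIndex) (v : IsDedekindDomain.HeightOneSpectrum (𝓞 ↥(maximalRealSubfield F))),
      LemD1_1AsPrinted
        (Def411WeilCarriers.localLemD1Data ↥(maximalRealSubfield F) F (IsCMField.complexConj F) 3 e (Matrix.diagonal dV) (complexConj_imagUnit F) (imagUnit_ne_zero F) (imagUnit_mul_self F) (realDiagonal_isSymm F dV hdV) (isUnit_det_realDiagonal F dV hdV hdV0) (realDiagonal_map F dV hdV).symm (r.toFun j.1.1)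
          (OmegaChiSplitting.chiLocalSplittingsD F e dV hdV hdV0 (toHeckeCharacter F μ) ((isOscillatorChar_toHeckeCharacter_iff μ).mpr hμ) (r.toFun j.1.1))
          hn (localMu F (toHeckeCharacter F μ)) (fun v x => norm_localMu F (toHeckeCharacter F μ) v (isUnitary_toHeckeCharacter F μ) x)
          (continuous_localMu F (toHeckeCharacter F μ))
          (fun v t => localMu_toLocalRing_eq_one_iff F (toHeckeCharacter F μ) v ((isOscillatorChar_toHeckeCharacter_iff μ).mpr hμ) t)
          j.1.2.1
          (Def411WeilCarriers.norm_chi_eq_one ↥(maximalRealSubfield F) F (IsCMField.complexConj F) (Algebra.IsQuadraticExtension.finrank_eq_two ↥(maximalRealSubfield F) F)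
            (UnitaryGroup.algEquiv_ne_one_of_apply_eq_neg ↥(maximalRealSubfield F) F (IsCMField.complexConj F) (complexConj_imagUnit F) (imagUnit_ne_zero F)) j.1.2)
          j.1.2.2.1 v))
    (hD3 : ∀ v : IsDedekindDomain.HeightOneSpectrum (𝓞 ↥(maximalRealSubfield F)), LemD1_3AsPrintedI
      (Def411WeilCarriers.localIndexedFamilyAtV (ι := ((μw : {μ : Literature.NumberTheory.Automorphic.IdeleClassGroup F →ₜ* Circle // IdeleClassGroup.IsConjugateSymplectic F μ ∧ IdeleClassGroup.HasWeight F μ 1}) × (toThm418Data _ (restOfCharDeltaPrime h F h6 ι₁ V Φ e dV hdV hdV0 ιV r μw.1 μw.2.1 μw.2.2)).AdmIndex)) ↥(maximalRealSubfield F) F (IsCMField.complexConj F) 3 e (Matrix.diagonal dV) (complexConj_imagUnit F) (imagUnit_ne_zero F) (imagUnit_mul_self F) (realDiagonal_isSymm F dV hdV) (isUnit_det_realDiagonal F dV hdV hdV0) (realDiagonal_map F dV hdV).symm hn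
        (fun t => r.toFun t.2.1.1) (fun t => t.2.1.2)
        (fun t => OmegaChiSplitting.chiLocalSplittingsD F e dV hdV hdV0 (toHeckeCharacter F t.1.1) ((isOscillatorChar_toHeckeCharacter_iff t.1.1).mpr t.1.2.1) (r.toFun t.2.1.1))
        (fun t => localMu F (toHeckeCharacter F t.1.1))
        (fun t v x => norm_localMu F (toHeckeCharacter F t.1.1) v (isUnitary_toHeckeCharacter F t.1.1) x)
        (fun t => continuous_localMu F (toHeckeCharacter F t.1.1))
        (fun t v x => localMu_toLocalRing_eq_one_iff F (toHeckeCharacter F t.1.1) v ((isOscillatorChar_toHeckeCharacter_iff t.1.1).mpr t.1.2.1) x) v))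
    (s t : ((uniformOmegaRep h F ι₁ V Φ e dV hdV hdV0 ιV (2 * imagUnit F)⁻¹ (fun _ _ => r)).prop413Data H).AdmTriple)
    (hs : Nontrivial (((uniformOmegaRep h F ι₁ V Φ e dV hdV hdV0 ιV (2 * imagUnit F)⁻¹ (fun _ _ => r)).prop413Data H).omegaAt s))
    (hst : ∃ f : ((uniformOmegaRep h F ι₁ V Φ e dV hdV hdV0 ιV (2 * imagUnit F)⁻¹ (fun _ _ => r)).prop413Data H).omegaAt s ≃ₗ[ℂ] ((uniformOmegaRep h F ι₁ V Φ e dV hdV hdV0 ιV (2 * imagUnit F)⁻¹ (fun _ _ => r)).prop413Data H).omegaAt t,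
      ∀ (g : (sec42DataOf h isoOf F ι₁ V Φ).G) (v : ((uniformOmegaRep h F ι₁ V Φ e dV hdV hdV0 ιV (2 * imagUnit F)⁻¹ (fun _ _ => r)).prop413Data H).omegaAt s),
        f ((((uniformOmegaRep h F ι₁ V Φ e dV hdV hdV0 ιV (2 * imagUnit F)⁻¹ (fun _ _ => r)).prop413Data H).rhoAt s) g v) = (((uniformOmegaRep h F ι₁ V Φ e dV hdV hdV0 ιV (2 * imagUnit F)⁻¹ (fun _ _ => r)).prop413Data H).rhoAt t) g (f v)) :
    s.1.μ = t.1.μ := by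
  -- LIGHT internal index: the admissible triples of `U.prop413Data H` themselves; the DISPLAYED family (indexed by Σ (μ, hμ, hw, j) of the rest) is read
  -- on them along `t ↦ (⟨μ_t, _⟩, ⟨(ε_t, χ_t), _⟩)` by ✔ `LemD1_3AsPrintedI.comap` (an admissible triple IS an admissible index of the rest at its own μ —
  -- ✔ `UniformOmega.admTripleOfRest` read backwards; `restOfCharDeltaPrime = U.rest (restTailOne …)`, ✔ `restOfCharRep_eq_rest`, `rfl`)
  have key := Def411WeilCarriers.forall_localMu_eq_of_equiv_of_lemD1AsPrintedI (ι := ((uniformOmegaRep h F ι₁ V Φ e dV hdV hdV0 ιV (2 * imagUnit F)⁻¹ (fun _ _ => r)).prop413Data H).AdmTriple) ↥(maximalRealSubfield F) F (IsCMField.complexConj F) 3 e (Matrix.diagonal dV) (complexConj_imagUnit F) (imagUnit_ne_zero F) (imagUnit_mul_self F) (realDiagonal_isSymm F dV hdV) (isUnit_det_realDiagonal F dV hdV hdV0) (realDiagonal_map F dV hdV).symm hn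
    (fun t => r.toFun t.1.ε) (fun t => t.1.χ)
    (fun t => OmegaChiSplitting.chiLocalSplittingsD F e dV hdV hdV0 (toHeckeCharacter F t.1.μ)
      ((isOscillatorChar_toHeckeCharacter_iff t.1.μ).mpr t.1.isConjugateSymplectic) (r.toFun t.1.ε))
    (fun t => localMu F (toHeckeCharacter F t.1.μ))
    (fun t v x => norm_localMu F (toHeckeCharacter F t.1.μ) v (isUnitary_toHeckeCharacter F t.1.μ) x)
    (fun t => continuous_localMu F (toHeckeCharacter F t.1.μ))
    (fun t v x => localMu_toLocalRing_eq_one_iff F (toHeckeCharacter F t.1.μ) v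
      ((isOscillatorChar_toHeckeCharacter_iff t.1.μ).mpr t.1.isConjugateSymplectic) x)
    (fun t a => OmegaChiSplitting.hsChiD F e dV hdV hdV0 (toHeckeCharacter F t.1.μ) (isUnitary_toHeckeCharacter F t.1.μ)
      ((isOscillatorChar_toHeckeCharacter_iff t.1.μ).mpr t.1.isConjugateSymplectic) a)
    (fun t => OmegaChiSplitting.hfac_sChiD F e dV hdV hdV0 (toHeckeCharacter F t.1.μ) (isUnitary_toHeckeCharacter F t.1.μ)
      ((isOscillatorChar_toHeckeCharacter_iff t.1.μ).mpr t.1.isConjugateSymplectic) (r.toFun t.1.ε))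
    (fun t v => hD1R t.1.μ t.1.isConjugateSymplectic t.2.1 ⟨(t.1.ε, t.1.χ), t.2.2⟩ v)
    (fun v => by
      -- the displayed Σ-indexed family READ ON the triples (✔ `LemD1_3AsPrintedI.comap`), both families unfolded to their fields (`dsimp`: δ of the two
      -- family constructors + β∕ι only; no rewriting lemma) so that the member-wise identity is syntactic
      have h3 := (hD3 v).comap fun t : ((uniformOmegaRep h F ι₁ V Φ e dV hdV hdV0 ιV (2 * imagUnit F)⁻¹ (fun _ _ => r)).prop413Data H).AdmTriple =>
        (⟨⟨t.1.μ, t.1.isConjugateSymplectic, t.2.1⟩, ⟨(t.1.ε, t.1.χ), t.2.2⟩⟩ : ((μw : {μ : Literature.NumberTheory.Automorphic.IdeleClassGroup F →ₜ* Circle // IdeleClassGroup.IsConjugateSymplectic F μ ∧ IdeleClassGroup.HasWeight F μ 1}) × (toThm418Data _ (restOfCharDeltaPrime h F h6 ι₁ V Φ e dV hdV hdV0 ιV r μw.1 μw.2.1 μw.2.2)).AdmIndex))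
      dsimp only [LemD1IndexedFamily.comap, Def411WeilCarriers.localIndexedFamilyAtV] at h3 ⊢
      exact h3)
    hιV s t
  -- the triples' summands ARE those carriers (the carrier fields of `uniformOmegaRep` unfold), then weak approximation
  exact eq_of_forall_localMu_toHeckeCharacter_eq F s.1.μ t.1.μ (key hs hst)

/-! ## §2  THE END (7 rows) -/

set_option synthInstance.maxHeartbeats 400000 in
set_option maxHeartbeats 8000000 in
/-- **THE END «μ-KEY ⊕ ident − hμsep-LEG» (7 rows) — `HC_CM` FROM THE PRINTED CITATIONS, NO labelled leg.**  Displayed (7): `h` [Deligne 1979, 2.1.2 ∕ 2.2.5 ∕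
Cor. 2.7.21]; `h21` [Shimura 1998, Thm. 21.4]; `hLiu418` [Liu 2021, Thm. 4.18] AS PRINTED at the printed datum `D_print(a, ν)` (VERBATIM p375902's); `h411` [Def. 4.11]
AS PRINTED at `𝔯δ′⟦a, μ⟧`; `h413` [Prop. 4.13] AS PRINTED at the tower (index-keyed); `hD3` [App. D Lem. D.1 (3)] AS PRINTED at every finite place `v` of `F⁺`, read
on the indexed family of the tree's local data at `U(J_V)(F⁺_v)` of the admissible weight-one triples of `𝕌(a)` (NEW; scalar-keyed; index type
`(μw : {μ // conjugate-symplectic ∧ weight one}) × AdmIndex 𝔯δ′⟦a, μw⟧`); `hD1''` [App. D Lem. D.1 (1)] AS PRINTED per place, unguarded (VERBATIM).  NOT displayed: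
`hμsep` — DERIVED (§1 at the pin: restriction to `U(J_V)(F⁺_v)` [Flath Thm 3] with irreducible local types from `hD1''`, local separation from `hD3`, weak
approximation); `hLiuC ∕ hLiu ∕ hD1 ∕ hHom` as in p375902.  KERNEL: ONE application of ✔ `MuKeyIdentEnd.hc_cm_of_printed_citations_muKey_ident`.
HC_CM is NOT proved unconditionally: the seven displayed citations are hypotheses.
[cite: Liu2021, Thm. 4.18 (FJcycle.tex l. 2232–2245) and (2) with proof l. 2270, Rem. 4.4 (ll. 1912–1933), Def. 4.11 (l. 2083–2097), Def. 4.12 (l. 2102–2111), Prop. 4.13 (l. 2113–2119), Def. 4.16 (l. 2219), App. D §D.1 (l. 5213–5224), Lem. D.1 (1),(3) (l. 5226–5233)]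
[cite: Shimura1998, §21.4 Thm. 21.4] [cite: Deligne1979ShimuraVarieties, §2.1.2, 2.2.5 and Cor. 2.7.21] [cite: GelbartRogawski1991, §3.1 Prop. 3.1.1]
[cite: BergeronMillsonMoeglin2016, §3.5–3.6 and §3.11–3.13] [cite: FlathCorvallis1979, Theorem 3 (uniqueness clause)] [cite: CasselsFrohlichANT1967, Ch. VII §8] -/
theorem hc_cm_of_printed_citations_muKey_ident_lemD3
    (h : exists_recordSystem)
    (h21 : shimura1998_thm21_4_casselman)
    -- [Liu21, Thm 4.18] AS PRINTED at the PRINTED datum D_print(a, ν) — VERBATIM ✔ p375902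
    (hLiu418 : ∀ (F : HodgeCM.CMField) [IsGalois ℚ F] (h6 : 6 ≤ Module.finrank ℚ F) {ι₁ : F →+* ℂ} (V : HodgeCM.HermSpace3 F ι₁) (a : RealScalar F)
      (Φ : CMType F) (hΦ : ι₁ ∈ Φ.1) (ν : Literature.NumberTheory.Automorphic.IdeleClassGroup (F : Type) →ₜ* Circle)
      (hν : IdeleClassGroup.IsConjugateSymplectic (F : Type) ν) (hw : IdeleClassGroup.HasWeight (F : Type) ν 1),
      Thm418AsPrinted (toThm418Data (sec42DataOf h isoOf ⟨HodgeCM.CMField.K F⟩ ι₁ ⟨HodgeCM.HermSpace3.Hm V, HodgeCM.HermSpace3.isHermitian V, HodgeCM.HermSpace3.signature_ι₁ V, HodgeCM.HermSpace3.posDef_of_ne V⟩ Φ)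
        ((heckeTranslatesFamilyOf heckeTranslate_definedOver_holds h isoOf ⟨HodgeCM.CMField.K F⟩ ι₁ ⟨HodgeCM.HermSpace3.Hm V, HodgeCM.HermSpace3.isHermitian V, HodgeCM.HermSpace3.signature_ι₁ V, HodgeCM.HermSpace3.posDef_of_ne V⟩ Φ h6).restOne (AlgHom.id ℚ _) ι₁ hν hw (Def45.Carriers.ofPolDR ν (Def45.PolDR ι₁ hν (Def45.RMuForm ι₁ hν)))
        (uniformOmegaRep h ⟨HodgeCM.CMField.K F⟩ ι₁ ⟨HodgeCM.HermSpace3.Hm V, HodgeCM.HermSpace3.isHermitian V, HodgeCM.HermSpace3.signature_ι₁ V, HodgeCM.HermSpace3.posDef_of_ne V⟩ Φ e₁ (frameD V) (frameD_real V) (frameD_ne V) (ιVE V) (2 * imagUnit (HodgeCM.CMField.K F))⁻¹ (fun _ _ => (Rep.update ↥(maximalRealSubfield (HodgeCM.CMField.K F)) (imagUnitSq (HodgeCM.CMField.K F)) (Rep.ofLineOf ↥(maximalRealSubfield (HodgeCM.CMField.K F)) (imagUnitSq (HodgeCM.CMField.K F))) (locF ↥(maximalRealSubfield (HodgeCM.CMField.K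 F)) (imagUnitSq (HodgeCM.CMField.K F)) (realUnit ⟨HodgeCM.CMField.K F⟩ a.1 a.2.1 a.2.2)) (realUnit ⟨HodgeCM.CMField.K F⟩ a.1 a.2.1 a.2.2) rfl))).Eps
        (fun e => (uniformOmegaRep h ⟨HodgeCM.CMField.K F⟩ ι₁ ⟨HodgeCM.HermSpace3.Hm V, HodgeCM.HermSpace3.isHermitian V, HodgeCM.HermSpace3.signature_ι₁ V, HodgeCM.HermSpace3.posDef_of_ne V⟩ Φ e₁ (frameD V) (frameD_real V) (frameD_ne V) (ιVE V) (2 * imagUnit (HodgeCM.CMField.K F))⁻¹ (fun _ _ => (Rep.update ↥(maximalRealSubfield (HodgeCM.CMField.K F)) (imagUnitSq (HodgeCM.CMField.K F)) (Rep.ofLineOf ↥(maximalRealSubfield (HodgeCM.CMField.K F)) (imagUnitSq (HodgeCM.CMField.K F))) (locF ↥(maximalRealSubfield (HodgeCM.CMField.K F)) (imagUnitSq (HodgeCM.CMField.K F)) (realUnit ⟨HodgeCM.CMField.K F⟩ a.1 a.2.1 a.2.2)) (realUnit ⟨HodgeCM.CMField.K F⟩ a.1 a.2.1 a.2.2) rfl))).epsOf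 (-e))
        (uniformOmegaRep h ⟨HodgeCM.CMField.K F⟩ ι₁ ⟨HodgeCM.HermSpace3.Hm V, HodgeCM.HermSpace3.isHermitian V, HodgeCM.HermSpace3.signature_ι₁ V, HodgeCM.HermSpace3.posDef_of_ne V⟩ Φ e₁ (frameD V) (frameD_real V) (frameD_ne V) (ιVE V) (2 * imagUnit (HodgeCM.CMField.K F))⁻¹ (fun _ _ => (Rep.update ↥(maximalRealSubfield (HodgeCM.CMField.K F)) (imagUnitSq (HodgeCM.CMField.K F)) (Rep.ofLineOf ↥(maximalRealSubfield (HodgeCM.CMField.K F)) (imagUnitSq (HodgeCM.CMField.K F))) (locF ↥(maximalRealSubfield (HodgeCM.CMField.K F)) (imagUnitSq (HodgeCM.CMField.K F)) (realUnit ⟨HodgeCM.CMField.K F⟩ a.1 a.2.1 a.2.2)) (realUnit ⟨HodgeCM.CMField.K F⟩ a.1 a.2.1 a.2.2) rfl))).Chi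
        ((uniformOmegaRep h ⟨HodgeCM.CMField.K F⟩ ι₁ ⟨HodgeCM.HermSpace3.Hm V, HodgeCM.HermSpace3.isHermitian V, HodgeCM.HermSpace3.signature_ι₁ V, HodgeCM.HermSpace3.posDef_of_ne V⟩ Φ e₁ (frameD V) (frameD_real V) (frameD_ne V) (ιVE V) (2 * imagUnit (HodgeCM.CMField.K F))⁻¹ (fun _ _ => (Rep.update ↥(maximalRealSubfield (HodgeCM.CMField.K F)) (imagUnitSq (HodgeCM.CMField.K F)) (Rep.ofLineOf ↥(maximalRealSubfield (HodgeCM.CMField.K F)) (imagUnitSq (HodgeCM.CMField.K F))) (locF ↥(maximalRealSubfield (HodgeCM.CMField.K F)) (imagUnitSq (HodgeCM.CMField.K F)) (realUnit ⟨HodgeCM.CMField.K F⟩ a.1 a.2.1 a.2.2)) (realUnit ⟨HodgeCM.CMField.K F⟩ a.1 a.2.1 a.2.2) rfl))).omega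
        (galConj (IsCMField.complexConj _) ν) hν.galConj)
        ((uniformOmegaRep h ⟨HodgeCM.CMField.K F⟩ ι₁ ⟨HodgeCM.HermSpace3.Hm V, HodgeCM.HermSpace3.isHermitian V, HodgeCM.HermSpace3.signature_ι₁ V, HodgeCM.HermSpace3.posDef_of_ne V⟩ Φ e₁ (frameD V) (frameD_real V) (frameD_ne V) (ιVE V) (2 * imagUnit (HodgeCM.CMField.K F))⁻¹ (fun _ _ => (Rep.update ↥(maximalRealSubfield (HodgeCM.CMField.K F)) (imagUnitSq (HodgeCM.CMField.K F)) (Rep.ofLineOf ↥(maximalRealSubfield (HodgeCM.CMField.K F)) (imagUnitSq (HodgeCM.CMField.K F))) (locF ↥(maximalRealSubfield (HodgeCM.CMField.K F)) (imagUnitSq (HodgeCM.CMField.K F)) (realUnit ⟨HodgeCM.CMField.K F⟩ a.1 a.2.1 a.2.2)) (realUnit ⟨HodgeCM.CMField.K F⟩ a.1 a.2.1 a.2.2) rfl))).rho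
        (galConj (IsCMField.complexConj _) ν) hν.galConj))))
    -- [Liu21, Def 4.11] ∕ [Prop 4.13] — VERBATIM ✔ p375902 (= ✔ p375090)
    (h411 : ∀ (F : HodgeCM.CMField) [IsGalois ℚ F] (h6 : 6 ≤ Module.finrank ℚ F) {ι₁ : F →+* ℂ} (V : HodgeCM.HermSpace3 F ι₁) (a : RealScalar F)
      (Φ : CMType F) (hΦ : ι₁ ∈ Φ.1) (μ : Literature.NumberTheory.Automorphic.IdeleClassGroup (F : Type) →ₜ* Circle)
      (hμ : IdeleClassGroup.IsConjugateSymplectic (F : Type) μ) (hw : IdeleClassGroup.HasWeight (F : Type) μ 1),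
      Def411AsPrinted (toThm418Data _ (restOfCharDeltaPrime h ⟨HodgeCM.CMField.K F⟩ h6 ι₁ ⟨HodgeCM.HermSpace3.Hm V, HodgeCM.HermSpace3.isHermitian V, HodgeCM.HermSpace3.signature_ι₁ V, HodgeCM.HermSpace3.posDef_of_ne V⟩ Φ e₁ (frameD V) (frameD_real V) (frameD_ne V) (ιVE V) (Rep.update ↥(maximalRealSubfield (HodgeCM.CMField.K F)) (imagUnitSq (HodgeCM.CMField.K F)) (Rep.ofLineOf ↥(maximalRealSubfield (HodgeCM.CMField.K F)) (imagUnitSq (HodgeCM.CMField.K F))) (locF ↥(maximalRealSubfield (HodgeCM.CMField.K F)) (imagUnitSq (HodgeCM.CMField.K F)) (realUnit ⟨HodgeCM.CMField.K F⟩ a.1 a.2.1 a.2.2)) (realUnit ⟨HodgeCM.CMField.K F⟩ a.1 a.2.1 a.2.2) rfl) μ hμ hw)))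
    (h413 : ∀ (F : HodgeCM.CMField) [IsGalois ℚ F] (h6 : 6 ≤ Module.finrank ℚ F) {ι₁ : F →+* ℂ} (V : HodgeCM.HermSpace3 F ι₁) (a₀ : RealScalar F)
      (Φ : CMType F) (hΦ : ι₁ ∈ Φ.1) (i : (I V (repAt a₀) (muLiu ι₁ GramClass.rep))), Prop413AsPrinted (((uniformOmegaRep h ⟨HodgeCM.CMField.K F⟩ ι₁ ⟨HodgeCM.HermSpace3.Hm V, HodgeCM.HermSpace3.isHermitian V, HodgeCM.HermSpace3.signature_ι₁ V, HodgeCM.HermSpace3.posDef_of_ne V⟩ Φ e₁ (frameD V) (frameD_real V) (frameD_ne V) (ιVE V) (2 * imagUnit (HodgeCM.CMField.K F))⁻¹ (fun _ _ => (Rep.update ↥(maximalRealSubfield (HodgeCM.CMField.K F)) (imagUnitSq (HodgeCM.CMField.K F)) (Rep.ofLineOf ↥(maximalRealSubfield (HodgeCM.CMField.K F)) (imagUnitSq (HodgeCM.CMField.K F))) (locF ↥(maximalRealSubfield (HodgeCM.CMField.K F)) (imagUnitSq (HodgeCM.CMField.K F)) (realUnit ⟨HodgeCM.CMField.K F⟩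 (repAt a₀ (Sigma.fst i)).1 (repAt a₀ (Sigma.fst i)).2.1 (repAt a₀ (Sigma.fst i)).2.2)) (realUnit ⟨HodgeCM.CMField.K F⟩ (repAt a₀ (Sigma.fst i)).1 (repAt a₀ (Sigma.fst i)).2.1 (repAt a₀ (Sigma.fst i)).2.2) rfl)))).prop413Data ((liuDictionaryPin exists_isReal_hodgeModel_holds hodgePQ_independent_of_hodgeModel_holds BallQuotient.ballQuotientUniformised_holds (cmAbelianVarietyRealised_of_eigenbasis exists_isReal_hodgeModel_holds hodgePQ_independent_of_hodgeModel_holds cmAbelianVarietyEigenbasisRealised_holds) Literature.NumberTheory.Transcendental.arapura2012_cor_15_4_6_holds V (I V (repAt a₀) (muLiu ι₁ GramClass.rep)) (line V (repAt a₀) (muLiu ι₁ GramClass.rep)))).H))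
    -- [Liu21, App. D Lem D.1 (3)] AS PRINTED per place, read on the INDEXED FAMILY of the tree's own local data at U(J_V)(F⁺_v) of the admissible weight-one triples of 𝕌(a) — scalar-keyed
    (hD3 : ∀ (F : HodgeCM.CMField) [IsGalois ℚ F] (h6 : 6 ≤ Module.finrank ℚ F) {ι₁ : F →+* ℂ} (V : HodgeCM.HermSpace3 F ι₁) (a : RealScalar F)
      (Φ : CMType F) (hΦ : ι₁ ∈ Φ.1) (v : IsDedekindDomain.HeightOneSpectrum (𝓞 ↥(maximalRealSubfield (F : Type)))),
      LemD1_3AsPrintedI (Def411WeilCarriers.localIndexedFamilyAtV (ι := ((μw : {μ : Literature.NumberTheory.Automorphic.IdeleClassGroup (F : Type) →ₜ* Circle // IdeleClassGroup.IsConjugateSymplectic (F : Type) μ ∧ IdeleClassGroup.HasWeight (F : Type) μ 1}) × (toThm418Data _ (restOfCharDeltaPrime h ⟨HodgeCM.CMField.K F⟩ h6 ι₁ ⟨HodgeCM.HermSpace3.Hm V, HodgeCM.HermSpace3.isHermitian V, HodgeCM.HermSpace3.signature_ι₁ V, HodgeCM.HermSpace3.posDef_of_ne V⟩ Φ e₁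 (frameD V) (frameD_real V) (frameD_ne V) (ιVE V) (Rep.update ↥(maximalRealSubfield (HodgeCM.CMField.K F)) (imagUnitSq (HodgeCM.CMField.K F)) (Rep.ofLineOf ↥(maximalRealSubfield (HodgeCM.CMField.K F)) (imagUnitSq (HodgeCM.CMField.K F))) (locF ↥(maximalRealSubfield (HodgeCM.CMField.K F)) (imagUnitSq (HodgeCM.CMField.K F)) (realUnit ⟨HodgeCM.CMField.K F⟩ a.1 a.2.1 a.2.2)) (realUnit ⟨HodgeCM.CMField.K F⟩ a.1 a.2.1 a.2.2) rfl) μw.1 μw.2.1 μw.2.2)).AdmIndex)) ↥(maximalRealSubfield (F : Type)) (F : Type) (IsCMField.complexConj (F : Type)) 3 e₁ (Matrix.diagonal (frameD V)) (complexConj_imagUnit (F : Type)) (imagUnit_ne_zero (F : Type)) (imagUnit_mul_self (F : Type)) (realDiagonal_isSymm (F : Type) (frameD V) (frameD_real V)) (isUnit_det_realDiagonal (F : Type) (frameD V) (frameD_real V) (frameD_ne V)) (realDiagonal_map (F : Type) (frameD V) (frameD_real V)).symm (le_refl 3) (fun t => (Rep.update ↥(maximalRealSubfield (HodgeCM.CMField.K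 F)) (imagUnitSq (HodgeCM.CMField.K F)) (Rep.ofLineOf ↥(maximalRealSubfield (HodgeCM.CMField.K F)) (imagUnitSq (HodgeCM.CMField.K F))) (locF ↥(maximalRealSubfield (HodgeCM.CMField.K F)) (imagUnitSq (HodgeCM.CMField.K F)) (realUnit ⟨HodgeCM.CMField.K F⟩ a.1 a.2.1 a.2.2)) (realUnit ⟨HodgeCM.CMField.K F⟩ a.1 a.2.1 a.2.2) rfl).toFun t.2.1.1) (fun t => t.2.1.2) (fun t => OmegaChiSplitting.chiLocalSplittingsD ⟨HodgeCM.CMField.K F⟩ e₁ (frameD V) (frameD_real V) (frameD_ne V) (toHeckeCharacter (F : Type) t.1.1) ((isOscillatorChar_toHeckeCharacter_iff t.1.1).mpr t.1.2.1) ((Rep.update ↥(maximalRealSubfield (HodgeCM.CMField.K F)) (imagUnitSq (HodgeCM.CMField.K F)) (Rep.ofLineOf ↥(maximalRealSubfield (HodgeCM.CMField.K F)) (imagUnitSq (HodgeCM.CMField.K F))) (locF ↥(maximalRealSubfield (HodgeCM.CMField.K F)) (imagUnitSq (HodgeCM.CMField.K F)) (realUnit ⟨HodgeCM.CMField.K F⟩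 a.1 a.2.1 a.2.2)) (realUnit ⟨HodgeCM.CMField.K F⟩ a.1 a.2.1 a.2.2) rfl).toFun t.2.1.1)) (fun t => localMu (F : Type) (toHeckeCharacter (F : Type) t.1.1)) (fun t v x => norm_localMu (F : Type) (toHeckeCharacter (F : Type) t.1.1) v (isUnitary_toHeckeCharacter (F : Type) t.1.1) x) (fun t => continuous_localMu (F : Type) (toHeckeCharacter (F : Type) t.1.1)) (fun t v x => localMu_toLocalRing_eq_one_iff (F : Type) (toHeckeCharacter (F : Type) t.1.1) v ((isOscillatorChar_toHeckeCharacter_iff t.1.1).mpr t.1.2.1) x) v))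
    -- [Liu21, App. D Lem D.1 (1)] AS PRINTED per place at the local data of 𝔯δ′⟦a, μ⟧ — VERBATIM ✔ p375902, UNGUARDED
    (hD1'' : ∀ (F : HodgeCM.CMField) [IsGalois ℚ F] (h6 : 6 ≤ Module.finrank ℚ F) {ι₁ : F →+* ℂ} (V : HodgeCM.HermSpace3 F ι₁) (a : RealScalar F)
      (Φ : CMType F) (hΦ : ι₁ ∈ Φ.1) (μ : Literature.NumberTheory.Automorphic.IdeleClassGroup (F : Type) →ₜ* Circle)
      (hμ : IdeleClassGroup.IsConjugateSymplectic (F : Type) μ) (hw : IdeleClassGroup.HasWeight (F : Type) μ 1)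
      (j : (toThm418Data _ (restOfCharDeltaPrime h ⟨HodgeCM.CMField.K F⟩ h6 ι₁ ⟨HodgeCM.HermSpace3.Hm V, HodgeCM.HermSpace3.isHermitian V, HodgeCM.HermSpace3.signature_ι₁ V, HodgeCM.HermSpace3.posDef_of_ne V⟩ Φ e₁ (frameD V) (frameD_real V) (frameD_ne V) (ιVE V) (Rep.update ↥(maximalRealSubfield (HodgeCM.CMField.K F)) (imagUnitSq (HodgeCM.CMField.K F)) (Rep.ofLineOf ↥(maximalRealSubfield (HodgeCM.CMField.K F)) (imagUnitSq (HodgeCM.CMField.K F))) (locF ↥(maximalRealSubfield (HodgeCM.CMField.K F)) (imagUnitSq (HodgeCM.CMField.K F)) (realUnit ⟨HodgeCM.CMField.K F⟩ a.1 a.2.1 a.2.2)) (realUnit ⟨HodgeCM.CMField.K F⟩ a.1 a.2.1 a.2.2) rfl) μ hμ hw)).AdmIndex) (v : IsDedekindDomain.HeightOneSpectrum (𝓞 ↥(maximalRealSubfield (F : Type)))),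
      LemD1_1AsPrinted
        (Def411WeilCarriers.localLemD1Data ↥(maximalRealSubfield (F : Type)) (F : Type) (IsCMField.complexConj (F : Type)) 3 e₁
          (Matrix.diagonal (frameD V)) (complexConj_imagUnit (F : Type)) (imagUnit_ne_zero (F : Type)) (imagUnit_mul_self (F : Type))
          (realDiagonal_isSymm (F : Type) (frameD V) (frameD_real V)) (isUnit_det_realDiagonal (F : Type) (frameD V) (frameD_real V) (frameD_ne V))
          (realDiagonal_map (F : Type) (frameD V) (frameD_real V)).symm (((Rep.update ↥(maximalRealSubfield (HodgeCM.CMField.K F)) (imagUnitSq (HodgeCM.CMField.K F)) (Rep.ofLineOf ↥(maximalRealSubfield (HodgeCM.CMField.K F)) (imagUnitSq (HodgeCM.CMField.K F))) (locF ↥(maximalRealSubfield (HodgeCM.CMField.K F)) (imagUnitSq (HodgeCM.CMField.K F)) (realUnit ⟨HodgeCM.CMField.K F⟩ a.1 a.2.1 a.2.2)) (realUnit ⟨HodgeCM.CMField.K F⟩ a.1 a.2.1 a.2.2) rfl)).toFun j.1.1)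
          (OmegaChiSplitting.chiLocalSplittingsD ⟨HodgeCM.CMField.K F⟩ e₁ (frameD V) (frameD_real V) (frameD_ne V) (toHeckeCharacter (F : Type) μ)
            ((isOscillatorChar_toHeckeCharacter_iff μ).mpr hμ) (((Rep.update ↥(maximalRealSubfield (HodgeCM.CMField.K F)) (imagUnitSq (HodgeCM.CMField.K F)) (Rep.ofLineOf ↥(maximalRealSubfield (HodgeCM.CMField.K F)) (imagUnitSq (HodgeCM.CMField.K F))) (locF ↥(maximalRealSubfield (HodgeCM.CMField.K F)) (imagUnitSq (HodgeCM.CMField.K F)) (realUnit ⟨HodgeCM.CMField.K F⟩ a.1 a.2.1 a.2.2)) (realUnit ⟨HodgeCM.CMField.K F⟩ a.1 a.2.1 a.2.2) rfl)).toFun j.1.1))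
          (le_refl 3) (localMu (F : Type) (toHeckeCharacter (F : Type) μ))
          (fun v x => norm_localMu (F : Type) (toHeckeCharacter (F : Type) μ) v (isUnitary_toHeckeCharacter (F : Type) μ) x)
          (continuous_localMu (F : Type) (toHeckeCharacter (F : Type) μ))
          (fun v t => localMu_toLocalRing_eq_one_iff (F : Type) (toHeckeCharacter (F : Type) μ) v ((isOscillatorChar_toHeckeCharacter_iff μ).mpr hμ) t)
          j.1.2.1
          (Def411WeilCarriers.norm_chi_eq_one ↥(maximalRealSubfield (F : Type)) (F : Type) (IsCMField.complexConj (F : Type))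
            (Algebra.IsQuadraticExtension.finrank_eq_two ↥(maximalRealSubfield (F : Type)) (F : Type))
            (UnitaryGroup.algEquiv_ne_one_of_apply_eq_neg ↥(maximalRealSubfield (F : Type)) (F : Type) (IsCMField.complexConj (F : Type))
              (complexConj_imagUnit (F : Type)) (imagUnit_ne_zero (F : Type))) j.1.2)
          j.1.2.2.1 v))
    : HC_CM :=
  hc_cm_of_printed_citations_muKey_ident h h21 hLiu418 h411 h413
    (fun F hG h6 {ι₁} V a₀ Φ hΦ i s t hs hst => by
      haveI : IsGalois ℚ F := hG
      exact mu_eq_of_areIsomorphic_uniformOmegaRep_of_lemD1_3AsPrintedI h ⟨HodgeCM.CMField.K F⟩ h6 ι₁ ⟨HodgeCM.HermSpace3.Hm V, HodgeCM.HermSpace3.isHermitian V, HodgeCM.HermSpace3.signature_ι₁ V, HodgeCM.HermSpace3.posDef_of_ne V⟩ Φ e₁ (frameD V) (frameD_real V) (frameD_ne V) (ιVE V)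
        (Rep.update ↥(maximalRealSubfield (HodgeCM.CMField.K F)) (imagUnitSq (HodgeCM.CMField.K F)) (Rep.ofLineOf ↥(maximalRealSubfield (HodgeCM.CMField.K F)) (imagUnitSq (HodgeCM.CMField.K F))) (locF ↥(maximalRealSubfield (HodgeCM.CMField.K F)) (imagUnitSq (HodgeCM.CMField.K F)) (realUnit ⟨HodgeCM.CMField.K F⟩ (repAt a₀ (Sigma.fst i)).1 (repAt a₀ (Sigma.fst i)).2.1 (repAt a₀ (Sigma.fst i)).2.2)) (realUnit ⟨HodgeCM.CMField.K F⟩ (repAt a₀ (Sigma.fst i)).1 (repAt a₀ (Sigma.fst i)).2.1 (repAt a₀ (Sigma.fst i)).2.2) rfl) (le_refl 3)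
        ((liuDictionaryPin exists_isReal_hodgeModel_holds hodgePQ_independent_of_hodgeModel_holds BallQuotient.ballQuotientUniformised_holds (cmAbelianVarietyRealised_of_eigenbasis exists_isReal_hodgeModel_holds hodgePQ_independent_of_hodgeModel_holds cmAbelianVarietyEigenbasisRealised_holds) Literature.NumberTheory.Transcendental.arapura2012_cor_15_4_6_holds V (I V (repAt a₀) (muLiu ι₁ GramClass.rep)) (line V (repAt a₀) (muLiu ι₁ GramClass.rep)))).H
        (UnitaryDualPair.finPart_cmKTypeHom_finAdelicToAdelic_surjective (F : Type) V.Hm (frameG V) (frameD V) (frame_congr V))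
        (fun μ hμ hw j v => hD1'' F h6 V (repAt a₀ (Sigma.fst i)) Φ hΦ μ hμ hw j v) (hD3 F h6 V (repAt a₀ (Sigma.fst i)) Φ hΦ) s t hs hst)
    hD1''

end Summit.HodgeConjecture.CorCM.D2Bridge.MuKeyIdentLemD3End

end
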